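import Literature.AlgebraicGeometry.AbelianSchemes.SerreTwistExactPolarizationExists      -- ★ (LA3-p01) `exists_serreTranslate_comp_eq_i_of_mem`, `IsExactTwistPol`, hom descent along `ψ_P`
import Literature.AlgebraicGeometry.AbelianSchemes.SerreTwistExactPolarizationAmple       -- ★ p849801 `exists_polarization_lam_eq_of_isExactTwistPol`
import Literature.AlgebraicGeometry.AbelianSchemes.SerreTwistPolarizationCompatible       -- ★ `serreAction_i_comp_of_isExactTwistPol` (the twisted `λ′` is `𝒪`-compatible)
import Literature.AlgebraicGeometry.AbelianSchemes.DualIsogenyMul                          -- ★ `DualPair.dualIsogenyOver_mul` (`f ↦ f^∨` is additive)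
import Literature.AlgebraicGeometry.AbelianSchemes.AbelianSchemeDualRingAction             -- ★ `RingAction.dual` (`ι^∨`), `RingAction.dual_i`
import HarnessLib

/-!
# The exact Serre-twisted polarisation from the NORM ROW `(N) ⊆ 𝔭·𝔮` alone (no Rosati pair)

Organ **(N2) «POL-(a)»** of the sheet line `ESHEET` of crux `hLiu418` (cell `hodgecm-mathlib`, F0/P6 «GO 500», road (γ′) «Serre tensor over `X`,
classified», E-pen A-p01 (g28) 2026-09-02 08:39:31Z; prover seat LA7-p01 (g3)).

★ `exists_isExactTwistPol_of_rosatiPair` (LA3-p01) produces the exact twisted polarisation `λ′ : A ⊗ 𝔟 → (A ⊗ 𝔟)^` with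
`ψ_P ≫ λ′ ≫ ψ_P^∨ = λ ≫ [N]` from a ROSATI PAIR `(a, b)` (`ι(a) ≫ λ = λ ≫ ι(b)^∨`, `1 − a ∈ 𝔭`, `b ∈ 𝔭`), which for a CM action with Rosati
involution `σ` exists only when `𝔭 + σ𝔭 = (1)`.  This file removes that hypothesis: it suffices that

* `λ` is `σ`-compatible, `ι(σ x) ≫ λ = λ ≫ ι(x)^∨` for all `x` (the Kottwitz–RSZ condition, print's `(ι, λ)` compatibility), and
* the similitude scalar `N` (the presentation scalar, `QP = N`) lies in the PRODUCT IDEAL `𝔭 · 𝔮` for some ideal `𝔮` with `σ(𝔮) ⊆ 𝔭`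

— for `𝒪 = 𝒪_F` of a CM field, `σ` = complex conjugation and `𝔮 := σ𝔭`, this is exactly the norm row `𝔭 · σ𝔭 = (N)` of the sheet junction,
with NO coprimality of `𝔭` and `σ𝔭` (inert and ramified `𝔭` allowed).

## The argument ([MumfordAV1970] §23 isotropy, done pairing-free)

* §1 For `r ∈ 𝔭·𝔮` there is a homomorphism `d_r : A ⊗ 𝔟 → A` with `ψ_P ≫ d_r = ι(r)` whose DUAL `d_r^∨ : Â → (A ⊗ 𝔟)^` KILLS every point of
  `Â` killed by `ι^∨(𝔮)`: for `r = b c` (`b ∈ 𝔭`, `c ∈ 𝔮`) take `d_r := d_b ≫ ι(c)` with `ψ_P ≫ d_b = ι(b)` (★ `exists_serreTranslate_comp_eq_i_of_mem`),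
  so `d_r^∨ = ι(c)^∨ ≫ d_b^∨` (★ `dualIsogenyOver_comp`); sums by `d_{r+r′} := d_r · d_{r′}` and ★ `dualIsogenyOver_mul` (`Submodule.mul_induction_on`).
* §2 With `r := N`: `κ := λ ≫ d_N^∨ : A → (A ⊗ 𝔟)^` kills `Ker ψ_P = A[𝔭]` — for `t ∈ A[𝔭]` and `c ∈ 𝔮`, `t ≫ λ ≫ ι(c)^∨ = t ≫ ι(σ c) ≫ λ = 1` as
  `σ c ∈ 𝔭` — hence descends along the fpqc cover `ψ_P`: `κ = ψ_P ≫ λ′` (★ `exists_isMonHom_comp_eq_of_forall_comp_eq_one`), and then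
  `ψ_P ≫ λ′ ≫ ψ_P^∨ = λ ≫ (ψ_P ≫ d_N)^∨ = λ ≫ ι(N)^∨ = λ ≫ [N]` (★ `dualIsogenyOver_comp`, ★ `dualIsogenyOver_mulN`): `IsExactTwistPol … N λ′`.
* §3 Consequences by ★: `λ′` is a polarisation over a characteristic-`0` field base (★ p849801 `exists_polarization_lam_eq_of_isExactTwistPol`), unique
  (★ `IsExactTwistPol.eq`), and the CM-field specialisation (`𝒪 = 𝒪_F`, `𝔮 = σ𝔭`, norm row `Ideal.span {N} = 𝔭 * σ•𝔭`).

References: [MumfordAV1970] §23 Thm. 2 (p. 231) (descent of polarisations through isogenies with isotropic kernel); [RapoportSmithlingZhang2020Diagonal]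
§3.2 (p. 11) and §4.3 (4.23) (p. 21) (the `λ`-exact Serre twist `A ⊗ 𝔞⁻¹`); [Shimura1998] §18.6 Thm. 18.6 (pp. 124–125) (the `𝔞`-multiplication
`(zΛ, N(𝔞)⁻¹ψ)`); [Kottwitz1992] §5 (p. 390) (compatibility of `ι` and `λ`).
-/

set_option autoImplicit false

noncomputable section

universe u

open CategoryTheory CategoryTheory.Limits AlgebraicGeometry MonObj

namespace Literature.AlgebraicGeometry.AbelianSchemes

namespace AbelianSchemeOver

variable {S : Scheme.{u}} [IsReduced S] [IsLocallyNoetherian S] {A : AbelianSchemeOver S} {O : Type*} [CommRing O] (act : A.RingAction O)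
  [IsCommMonObj A.X] {m : ℕ} (E' : Matrix (Fin m) (Fin m) O) (hE' : E' * E' = E') (P : Matrix (Fin m) (Fin 1) O) (Q : Matrix (Fin 1) (Fin m) O)
  {N : ℕ} (D : A.DualPair) (Db : (serreTensor act E' hE').DualPair)
  (hD : Nonempty ((Scheme.Modules.pullback (DualPair.unitHatSlice D)).obj D.P ≅ SheafOfModules.unit _))
  (hDb : Nonempty ((Scheme.Modules.pullback (DualPair.unitHatSlice Db)).obj Db.P ≅ SheafOfModules.unit _))
  (pol : A.Polarization D)

/-! ## §1 `ι(r)` descends along `ψ_P` for `r ∈ 𝔭·𝔮`, with a dual killing the `ι^∨(𝔮)`-torsion of `Â` -/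

include hD hDb in
/-- **For `r ∈ 𝔭 · 𝔮`: `ι(r) = ψ_P ≫ d` with `d^∨` KILLING `Â[ι^∨(𝔮)]` on points.**  Base case `r = b c`: `d := d_b ≫ ι(c)` where `ψ_P ≫ d_b = ι(b)`
(★ `exists_serreTranslate_comp_eq_i_of_mem`), `d^∨ = ι(c)^∨ ≫ d_b^∨`; additivity by `d · d′` and ★ `dualIsogenyOver_mul`.
[cite: MumfordAV1970, §23 Thm. 2 (p. 231); §15 Thm. 1 (p. 143)] [cite: RapoportSmithlingZhang2020Diagonal, §3.2 (p. 11)] -/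
theorem exists_serreTranslate_comp_eq_i_dual_kills_of_mem_mul (hN : N ≠ 0) (hP : E' * P = P) (hQ : Q * E' = Q)
    (hQP : Q * P = Matrix.scalar (Fin 1) (N : O)) (hPQ : P * Q = Matrix.scalar (Fin m) (N : O) * E')
    {𝔭 : Ideal O} (h𝔭 : Ideal.span (Set.range fun k => P k 0) = 𝔭) (𝔮 : Ideal O) {r : O} (hr : r ∈ 𝔭 * 𝔮) :
    ∃ (d : (serreTensor act E' hE').X ⟶ A.X) (_ : IsMonHom d), serreTranslate act E' hE' P ≫ d = act.i r ∧
      ∀ ⦃T : Over S⦄ (s : T ⟶ D.hat.X), (∀ c ∈ 𝔮, s ≫ (act.dual D hD).i c = 1) →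
        s ≫ DualPair.dualIsogenyOver d Db D = 1 := by
  haveI := isMonHom_serreTranslate act E' hE' P
  refine Submodule.mul_induction_on hr (fun b hb c hc => ?_) (fun r₁ r₂ h₁ h₂ => ?_)
  · -- `r = b c`: `d := d_b ≫ ι(c)`
    obtain ⟨d, hd, hfac⟩ := exists_serreTranslate_comp_eq_i_of_mem act E' hE' P Q hN hP hQ hQP hPQ h𝔭 hb
    haveI := hd
    haveI := act.isMonHom c
    haveI : IsMonHom (DualPair.dualIsogenyOver d Db D) := DualPair.isMonHom_dualIsogenyOver d Db D hD hDb
    refine ⟨d ≫ act.i c, inferInstance, ?_, fun T s hs => ?_⟩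
    · rw [mul_comm b c, act.i_mul c b, ← Category.assoc, hfac]
    · rw [DualPair.dualIsogenyOver_comp d (act.i c) Db D D, ← Category.assoc]
      have hc' : s ≫ DualPair.dualIsogenyOver (act.i c) D D = 1 := hs c hc
      rw [hc', MonObj.one_comp]
  · -- `r = r₁ + r₂`: `d := d₁ · d₂`
    obtain ⟨d₁, hd₁, hfac₁, hkill₁⟩ := h₁
    obtain ⟨d₂, hd₂, hfac₂, hkill₂⟩ := h₂
    haveI := hd₁
    haveI := hd₂
    haveI : IsMonHom (d₁ * d₂) := A.isMonHom_mul d₁ d₂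
    refine ⟨d₁ * d₂, inferInstance, ?_, fun T s hs => ?_⟩
    · rw [MonObj.comp_mul, hfac₁, hfac₂, act.i_add]
    · rw [DualPair.dualIsogenyOver_mul D Db hDb d₁ d₂, MonObj.comp_mul, hkill₁ s hs, hkill₂ s hs, _root_.mul_one]

/-! ## §2 HEAD — the exact twisted polarisation from `N ∈ 𝔭·𝔮`, `σ(𝔮) ⊆ 𝔭` and the `σ`-compatibility of `λ` -/

include hD hDb in
/-- **THE EXACT SERRE-TWISTED POLARISATION EXISTS FROM THE NORM ROW ALONE.**  Over a reduced locally Noetherian base: if `λ` is `σ`-compatible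
(`ι(σ x) ≫ λ = λ ≫ ι(x)^∨`), `σ(𝔮) ⊆ 𝔭` and `N ∈ 𝔭 · 𝔮` (for a CM action: `𝔮 = σ𝔭`, `𝔭·σ𝔭 = (N)` — `𝔭` and `σ𝔭` need NOT be coprime), there is a homomorphism
`λ′ : A ⊗ 𝔟 → (A ⊗ 𝔟)^` with **`ψ_P ≫ λ′ ≫ ψ_P^∨ = λ ≫ [N]`** (★ `IsExactTwistPol … N λ′`): descend `κ := λ ≫ d_N^∨` (§1, `r := N`) along `ψ_P` — `κ` kills `A[𝔭]`
since `t ≫ λ ≫ ι(c)^∨ = t ≫ ι(σ c) ≫ λ = 1` for `c ∈ 𝔮` — and compute `ψ_P ≫ λ′ ≫ ψ_P^∨ = λ ≫ (ψ_P ≫ d_N)^∨ = λ ≫ ι(N)^∨ = λ ≫ [N]`.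
[cite: MumfordAV1970, §23 Thm. 2 (p. 231)] [cite: RapoportSmithlingZhang2020Diagonal, §3.2 (p. 11) and §4.3 (4.23) (p. 21)] [cite: Kottwitz1992, §5 (p. 390)] -/
theorem exists_isExactTwistPol_of_mem_mul (hN : N ≠ 0) (hP : E' * P = P) (hQ : Q * E' = Q)
    (hQP : Q * P = Matrix.scalar (Fin 1) (N : O)) (hPQ : P * Q = Matrix.scalar (Fin m) (N : O) * E')
    {𝔭 : Ideal O} (h𝔭 : Ideal.span (Set.range fun k => P k 0) = 𝔭) (𝔮 : Ideal O) (σ : O → O) (hσ : ∀ c ∈ 𝔮, σ c ∈ 𝔭)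
    (hN𝔮 : (N : O) ∈ 𝔭 * 𝔮) (hlam : ∀ x, act.i (σ x) ≫ pol.lam = pol.lam ≫ (act.dual D hD).i x) :
    ∃ lam' : (serreTensor act E' hE').X ⟶ Db.hat.X, IsMonHom lam' ∧ IsExactTwistPol act E' hE' P D Db pol N lam' := by
  haveI := isMonHom_serreTranslate act E' hE' P
  haveI := pol.isMonHom
  obtain ⟨dN, hdN, hfacN, hkill⟩ :=
    exists_serreTranslate_comp_eq_i_dual_kills_of_mem_mul act E' hE' P Q D Db hD hDb hN hP hQ hQP hPQ h𝔭 𝔮 hN𝔮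
  haveI := hdN
  haveI : IsMonHom (DualPair.dualIsogenyOver dN Db D) := DualPair.isMonHom_dualIsogenyOver dN Db D hD hDb
  haveI := flat_serreTranslate_left act E' hE' P Q hN hP hQ hQP hPQ
  haveI := surjective_serreTranslate_left act E' hE' P Q hN hP hQ hQP hPQ
  haveI := quasiCompact_serreTranslate_left act E' hE' P Q hN hP hQ hQP hPQ
  -- `κ := λ ≫ d_N^∨` kills `Ker ψ_P = A[𝔭]`
  obtain ⟨lam', hmon, hfac, -⟩ := A.exists_isMonHom_comp_eq_of_forall_comp_eq_one (serreTranslate act E' hE' P)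
    (pol.lam ≫ DualPair.dualIsogenyOver dN Db D) (fun T t ht => by
      have ht𝔭 := (comp_serreTranslate_eq_one_iff_forall_mem act E' hE' P hP h𝔭 t).mp ht
      rw [← Category.assoc]
      refine hkill (t ≫ pol.lam) fun c hc => ?_
      rw [Category.assoc, ← hlam c, ← Category.assoc, ht𝔭 (σ c) (hσ c hc), MonObj.one_comp])
  haveI := hmon
  refine ⟨lam', hmon, ?_⟩
  rw [isExactTwistPol_iff, ← Category.assoc, hfac, Category.assoc,
    ← DualPair.dualIsogenyOver_comp (serreTranslate act E' hE' P) dN D Db D]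
  have hfacN' : serreTranslate act E' hE' P ≫ dN = A.mulN N := by rw [hfacN, RingAction.i_natCast, mulN_def]
  haveI : IsMonHom (A.mulN N) := A.isMonHom_mulN N
  rw [DualPair.dualIsogenyOver_congr D D (h₂ := inferInstance) hfacN', D.dualIsogenyOver_mulN hD N]

include hD hDb in
/-- **… AND IT IS UNIQUE** (★ `IsExactTwistPol.eq`). [cite: MumfordAV1970, §23 Thm. 2 (p. 231)] [cite: RapoportSmithlingZhang2020Diagonal, §4.3 (4.23) (p. 21)] -/
theorem existsUnique_isExactTwistPol_of_mem_mul (hN : N ≠ 0) (hP : E' * P = P) (hQ : Q * E' = Q)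
    (hQP : Q * P = Matrix.scalar (Fin 1) (N : O)) (hPQ : P * Q = Matrix.scalar (Fin m) (N : O) * E')
    {𝔭 : Ideal O} (h𝔭 : Ideal.span (Set.range fun k => P k 0) = 𝔭) (𝔮 : Ideal O) (σ : O → O) (hσ : ∀ c ∈ 𝔮, σ c ∈ 𝔭)
    (hN𝔮 : (N : O) ∈ 𝔭 * 𝔮) (hlam : ∀ x, act.i (σ x) ≫ pol.lam = pol.lam ≫ (act.dual D hD).i x) :
    ∃! lam' : (serreTensor act E' hE').X ⟶ Db.hat.X, IsMonHom lam' ∧ IsExactTwistPol act E' hE' P D Db pol N lam' := by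
  obtain ⟨lam', hmon, hex⟩ := exists_isExactTwistPol_of_mem_mul act E' hE' P Q D Db hD hDb pol hN hP hQ hQP hPQ h𝔭 𝔮 σ hσ hN𝔮 hlam
  refine ⟨lam', ⟨hmon, hex⟩, fun lam'' h'' => ?_⟩
  haveI := hmon
  haveI := h''.1
  exact IsExactTwistPol.eq act E' hE' P Q D Db hDb pol hN hP hQ hQP hPQ h''.2 hex

/-! ## §3 Consequences: a POLARISATION over a characteristic-`0` field base, `𝒪`-compatible; the CM-field specialisation -/

include hD hDb in
/-- **THE EXACT TWISTED POLARISATION IS A POLARISATION** (ample witnesses at geometric points, ★ p849801) over a base over a field of characteristic `0`.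
[cite: MumfordAV1970, §23 Thm. 2 (p. 231)] [cite: MumfordFogartyKirwan1994, Ch. 6 §2 Definition 6.3 (p. 120)] [cite: RapoportSmithlingZhang2020Diagonal, §4.3 (4.23) (p. 21)] -/
theorem exists_polarization_isExactTwistPol_of_mem_mul {F : Type u} [Field F] [CharZero F] (f : S ⟶ Spec (.of F))
    (hN : N ≠ 0) (hP : E' * P = P) (hQ : Q * E' = Q)
    (hQP : Q * P = Matrix.scalar (Fin 1) (N : O)) (hPQ : P * Q = Matrix.scalar (Fin m) (N : O) * E')
    {𝔭 : Ideal O} (h𝔭 : Ideal.span (Set.range fun k => P k 0) = 𝔭) (𝔮 : Ideal O) (σ : O → O) (hσ : ∀ c ∈ 𝔮, σ c ∈ 𝔭)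
    (hN𝔮 : (N : O) ∈ 𝔭 * 𝔮) (hlam : ∀ x, act.i (σ x) ≫ pol.lam = pol.lam ≫ (act.dual D hD).i x) :
    ∃ pol' : (serreTensor act E' hE').Polarization Db, IsExactTwistPol act E' hE' P D Db pol N pol'.lam := by
  obtain ⟨lam', hmon, hex⟩ := exists_isExactTwistPol_of_mem_mul act E' hE' P Q D Db hD hDb pol hN hP hQ hQP hPQ h𝔭 𝔮 σ hσ hN𝔮 hlam
  haveI := hmon
  obtain ⟨pol', hpol'⟩ := exists_polarization_lam_eq_of_isExactTwistPol act E' hE' P Q D Db hD hDb pol f hN hP hQ hQP hPQ hex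
  exact ⟨pol', hpol' ▸ hex⟩

end AbelianSchemeOver

/-! ### §3b The CM-field specialisation: `𝒪 = 𝒪_F`, `σ` = complex conjugation, norm row `(N) = 𝔞 · c𝔞` -/

namespace AbelianSchemeOver

open NumberField
open scoped Pointwise

variable {S : Scheme.{0}} [IsReduced S] [IsLocallyNoetherian S] {A : AbelianSchemeOver S} {F : Type} [Field F] [NumberField F] [IsCMField F]
  (act : A.RingAction (𝓞 F)) [IsCommMonObj A.X] {m : ℕ} (E' : Matrix (Fin m) (Fin m) (𝓞 F)) (hE' : E' * E' = E')
  (P : Matrix (Fin m) (Fin 1) (𝓞 F)) (Q : Matrix (Fin 1) (Fin m) (𝓞 F)) {N : ℕ} (D : A.DualPair) (Db : (serreTensor act E' hE').DualPair)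
  (hD : Nonempty ((Scheme.Modules.pullback (DualPair.unitHatSlice D)).obj D.P ≅ SheafOfModules.unit _))
  (hDb : Nonempty ((Scheme.Modules.pullback (DualPair.unitHatSlice Db)).obj Db.P ≅ SheafOfModules.unit _))
  (pol : A.Polarization D)

/-- For a CM field, `c • 𝔞` is carried into `𝔞` by complex conjugation (`c` is an involution). [cite: Shimura1998, §18.6 (p. 124)] -/
theorem complexConj_smul_mem_of_mem_complexConj_smul (𝔞 : Ideal (𝓞 F)) {x : 𝓞 F} (hx : x ∈ (IsCMField.complexConj F) • 𝔞) :
    (IsCMField.complexConj F) • x ∈ 𝔞 := by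
  have h2 : IsCMField.complexConj F * IsCMField.complexConj F = 1 :=
    AlgEquiv.ext fun y => by rw [AlgEquiv.mul_apply, IsCMField.complexConj_apply_apply]; rfl
  have hinv : (IsCMField.complexConj F)⁻¹ = IsCMField.complexConj F := inv_eq_of_mul_eq_one_right h2
  have h := Ideal.mem_pointwise_smul_iff_inv_smul_mem.mp hx
  rwa [hinv] at h

include hD hDb in
/-- **(N2) «POL-(a)» FOR A CM ACTION.**  `A∕S` with an `𝒪_F`-action whose polarisation `λ` has Rosati involution the complex conjugation `c` (`ι(c x) ≫ λ = λ ≫ ι(x)^∨`),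
a Serre presentation `(E′, P, Q, N)` of `𝔞` and the NORM ROW `(N) = 𝔞 · c𝔞`: the Serre twist `A ⊗ 𝔟` (`𝔟 ≅ 𝔞⁻¹`) carries a polarisation `λ′` with `ψ_P ≫ λ′ ≫ ψ_P^∨ = λ ≫ [N]`
— for EVERY `𝔞 ≠ 0` prime to nothing (no `𝔞 + c𝔞 = (1)`), over any reduced locally Noetherian base over a characteristic-`0` field.
[cite: Shimura1998, §18.6 Thm. 18.6 (pp. 124–125)] [cite: RapoportSmithlingZhang2020Diagonal, §3.2 (p. 11) and §4.3 (4.23) (p. 21)] [cite: MumfordAV1970, §23 Thm. 2 (p. 231)] -/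
theorem exists_polarization_isExactTwistPol_of_span_eq_mul_complexConj {Fi : Type} [Field Fi] [CharZero Fi] (f : S ⟶ Spec (.of Fi))
    (hN : N ≠ 0) (hP : E' * P = P) (hQ : Q * E' = Q)
    (hQP : Q * P = Matrix.scalar (Fin 1) (N : 𝓞 F)) (hPQ : P * Q = Matrix.scalar (Fin m) (N : 𝓞 F) * E')
    {𝔞 : Ideal (𝓞 F)} (h𝔞 : Ideal.span (Set.range fun k => P k 0) = 𝔞)
    (hrow : Ideal.span {((N : ℕ) : 𝓞 F)} = 𝔞 * (IsCMField.complexConj F) • 𝔞)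
    (rosati : ∀ x, act.i ((IsCMField.complexConj F) • x) ≫ pol.lam = pol.lam ≫ (act.dual D hD).i x) :
    ∃ pol' : (serreTensor act E' hE').Polarization Db, IsExactTwistPol act E' hE' P D Db pol N pol'.lam :=
  exists_polarization_isExactTwistPol_of_mem_mul act E' hE' P Q D Db hD hDb pol f hN hP hQ hQP hPQ h𝔞
    ((IsCMField.complexConj F) • 𝔞) (fun x => (IsCMField.complexConj F) • x)
    (fun _ hc => complexConj_smul_mem_of_mem_complexConj_smul 𝔞 hc)
    (hrow ▸ Ideal.subset_span (Set.mem_singleton _)) rosati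

end AbelianSchemeOver

end Literature.AlgebraicGeometry.AbelianSchemes

end
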